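import Summits.HodgeConjecture.HodgeConjecture.Theorems.NikulinTwinTransportRealMultiplicationOfFacts

/-!
# Route NikulinTwinTransport · `RealMultiplicationSqrtTwoAlgebraic` (stmt-HodgeConjecture-13679) —
# the reduction made POINTWISE in the surface, and the item from RM-anchors

The item (real multiplication by `√2` on a projective K3 surface `S` is algebraic: a rational,
type-preserving, cup-self-adjoint `e` on `H²(S(ℂ); ℂ)` killing `NS := algebraicClasses S 1` with
`e² = 2` on `NS^⊥` is `[γ]_*` for an algebraic `γ` on `S × S`) is, standalone, an open sub-case of
the Hodge conjecture (van Geemen–Schütt 2023, Rem. 4.9: no inducing cycle is known on the maximal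
RM-`√2` families; Varesco 2023, Thm. 2.1 covers the Nikulin locus only). Seats 3 and 0 reduced it,
kernel-checked, to X = `TwinSimilitudeAlgebraic` (stmt-HodgeConjecture-13674) plus three named facts
(`realMultiplicationSqrtTwoAlgebraic_of_facts`). This file sharpens WHICH part of the route's
cruxes the deliverable actually consumes, by making the whole chain pointwise in `S`:

* `realMultiplication_algebraic_at` — for ONE projective K3 surface `S`: if the rational Hodge
  `2`-similitudes of `H²(S)` ITSELF are algebraic on `S × S` (X at the single pair `(S, S)`), then
  `e` is algebraic (seat 3's `e = Ξ − ν̃`, `Ξ = e + ν̃` a rational Hodge `2`-similitude by Witt,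
  `ν̃` a sum of divisor correspondences — algebraic by `divisorCorrespondence_of_fibreIntegral`,
  fibre integration by `fibreIntegral_of_kunnethTop` and the Künneth theorem
  `kunnethSpan_complexBetti`);
* `similitudeAlgebraic_at_of_anchor_at` — for ONE `S`: an algebraic anchor `r`-similitude
  `Ψ : H²(S″) ≃ H²(S)` into `S` (inverse rational, type-preserving, form `/r`) + Buskin's theorem
  (`HodgeIsometryAlgebraic`) + composition of algebraic correspondences between surfaces give X at
  every pair `(S, S′)` (pointwise form of `Theorems.similitudeAlgebraic_of_anchor`);
* `realMultiplication_algebraic_at_of_anchors_at` — the pointwise chain: anchors into `S` (one per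
  integral generator of `H⁴`) ⟹ `e` algebraic on `S`;
* `realMultiplicationSqrtTwoAlgebraic_of_rmAnchors` — the route decl BY NAME from RM-ANCHORS: the
  conclusion of the crux `TwinTransportRMPicardTwo` (stmt-HodgeConjecture-15067) for EVERY Picard
  rank (its body verbatim without the clause `finrank NS = 2`), Buskin, composition of
  correspondences, and the three named facts `Huybrechts_K3_marking_exists`,
  `Huybrechts_K3_hodgeTypes_H2`, `Grothendieck1969_supportedClasses_le_hodgeConiveau`.

Upshot for the planner: the deliverable hinges on the transport crux ONLY ON THE RM-`√2` SURFACES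
(all Picard ranks `2, 4, 6, 8, …`), not on the universal twin transport and not on X for all pairs;
conversely an anchor on one family settles real multiplication on that family
(`realMultiplication_algebraic_at_of_anchors_at`). Not here: any anchor (open), Buskin's theorem
(named fact `Buskin2019_hodgeIsometry_algebraic`, here the route decl `HodgeIsometryAlgebraic`),
the composition of correspondences (formal debt: moving lemma, see
`Theorems.twinAnchorGlue_of_moving`). Prover seat prover-pitem-stmt-HodgeConjecture-13679-1.

## References

* [Varesco2023] M. Varesco, Math. Z. 305 (2023), §2, Thm. 2.1, Rem. 2.2.
* [Buskin2019] N. Buskin, J. reine angew. Math. 755 (2019), Thm. 1.1, Lemma 6.3.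
* [VanGeemenSchuett2023] B. van Geemen, M. Schütt, arXiv:2310.05196, Thm. 3.10, Rem. 4.9.
* [HatcherAT2002] A. Hatcher, Algebraic Topology, CUP 2002, §3.2 Thm. 3.15.
-/

noncomputable section

namespace Summit.HodgeConjecture.HodgeConjecture.Theorems.NikulinTwinTransport

open scoped Manifold
open CategoryTheory MonoidalCategory SemiCartesianMonoidalCategory
open Literature.AlgebraicGeometry.Motives Literature.AlgebraicGeometry.HodgeTheory
open Literature.AlgebraicGeometry.Surfaces Literature.Geometry.Kaehler
open Literature.AlgebraicTopology.SingularHomology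

/-- **Real multiplication by `√2` on ONE projective K3 surface `S` is algebraic as soon as the
rational Hodge `2`-similitudes of `H²(S(ℂ); ℂ)` itself are algebraic on `S × S`** (pointwise form
of `realMultiplicationSqrtTwoAlgebraic_of_facts`: X = `TwinSimilitudeAlgebraic` is consumed only at
the pair `(S, S)`; markings, Hodge types of `H²(K3)` and Grothendieck's coniveau inclusion are the
three named facts; divisor correspondences come from the Künneth spanning theorem
`kunnethSpan_complexBetti` through `fibreIntegral_of_kunnethTop` and
`divisorCorrespondence_of_fibreIntegral`). Proof: seat 3's `e = Ξ − ν̃` with `Ξ = e + ν̃` a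
rational Hodge `2`-similitude of `H²(S)` (Witt) and `ν̃` a sum of divisor correspondences.
[cite: Varesco2023, Thm. 2.1 and Rem. 2.2] [cite: HatcherAT2002, §3.2 Thm. 3.15] -/
theorem realMultiplication_algebraic_at
    (hmark : Huybrechts_K3_marking_exists) (hHT : Huybrechts_K3_hodgeTypes_H2)
    (hG : Grothendieck1969_supportedClasses_le_hodgeConiveau)
    (μ : OrientationFamily) (hμ : μ.HasPoincareDuality) {S : SchemeOver ℂ} (hS : IsK3Surface S)
    (hXS : ∀ (p : complexBetti S (2 * 2)),
      (IsIntegralClass p ∧ ∀ q : complexBetti S (2 * 2), IsIntegralClass q → ∃ n : ℤ, q = n • p) →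
      ∀ (ψ : complexBetti S (2 * 1) →ₗ[ℂ] complexBetti S (2 * 1)),
        (∀ x, IsRationalClass x → IsRationalClass (ψ x)) →
        (∀ (i j : ℕ) x, IsOfHodgeType 2 S (2 * 1) i j x → IsOfHodgeType 2 S (2 * 1) i j (ψ x)) →
        (∀ (x y : complexBetti S (2 * 1)) (a : ℂ),
          cupProduct (rfl : 2 * 1 + 2 * 1 = 2 * 2) x y = a • p →
            cupProduct (rfl : 2 * 1 + 2 * 1 = 2 * 2) (ψ x) (ψ y) = ((2 : ℂ) * a) • p) →
        ∃ γ ∈ algebraicClasses (S ⊗ S) 2, ∀ x : complexBetti S (2 * 1),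
          ψ x = complexGysin μ (IsSmoothProjective.tensor_holds hS.1 hS.1) hS.1 (fst S S)
            (rfl : 2 * 1 + 2 * 2 + 2 * 2 = 2 * 1 + 2 * (2 + 2))
            (cupProduct (rfl : 2 * 1 + 2 * 2 = 2 * 1 + 2 * 2)
              (complexBetti.map (snd S S) (2 * 1) x) γ))
    (e : complexBetti S (2 * 1) →ₗ[ℂ] complexBetti S (2 * 1))
    (he_rat : ∀ x, IsRationalClass x → IsRationalClass (e x))
    (he_type : ∀ (i j : ℕ) x, IsOfHodgeType 2 S (2 * 1) i j x → IsOfHodgeType 2 S (2 * 1) i j (e x))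
    (he_adj : ∀ x y : complexBetti S (2 * 1),
      cupProduct (rfl : 2 * 1 + 2 * 1 = 2 * 2) (e x) y =
        cupProduct (rfl : 2 * 1 + 2 * 1 = 2 * 2) x (e y))
    (he_N : ∀ d ∈ algebraicClasses S 1, e d = 0)
    (he_T : ∀ x : complexBetti S (2 * 1),
      (∀ d ∈ algebraicClasses S 1, cupProduct (rfl : 2 * 1 + 2 * 1 = 2 * 2) x d = 0) →
        e (e x) = (2 : ℂ) • x) :
    ∃ γ ∈ algebraicClasses (S ⊗ S) 2, ∀ x : complexBetti S (2 * 1),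
      e x = complexGysin μ (IsSmoothProjective.tensor_holds hS.1 hS.1) hS.1 (fst S S)
        (rfl : 2 * 1 + 2 * 2 + 2 * 2 = 2 * 1 + 2 * (2 + 2))
        (cupProduct (rfl : 2 * 1 + 2 * 2 = 2 * 1 + 2 * 2)
          (complexBetti.map (snd S S) (2 * 1) x) γ) := by
  -- a marking of `S`
  obtain ⟨η, p₀, x₀, hp₀, ⟨hp₀int, hp₀gen, hηint, hηcup, h20, -⟩, ⟨-, hxpos, -⟩⟩ := hmark S hS
  -- the rational correction (Witt)
  obtain ⟨m, a, b, ξ, ha, hb, hξ, hKB⟩ :=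
    exists_ratCorrection hS η p₀ hp₀ hηint hηcup e he_rat he_adj he_N he_T
  -- the correction `ν̃ = Σᵢ (η(·).aᵢ) η⁻¹bᵢ`, a sum of rank-one maps
  set ψ : Fin m → (complexBetti S (2 * 1) →ₗ[ℂ] complexBetti S (2 * 1)) := fun i =>
    ((k3FormC.flip fun j => (a i j : ℂ)) ∘ₗ η.toLinearMap).smulRight (η.symm fun j => (b i j : ℂ))
    with hψdef
  have hψ : ∀ i x, ψ i x = k3Form (η x) (fun j => (a i j : ℂ)) • η.symm (fun j => (b i j : ℂ)) := by
    intro i x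
    rw [hψdef]
    change ((k3FormC.flip fun j => (a i j : ℂ)) ∘ₗ η.toLinearMap) x • η.symm (fun j => (b i j : ℂ)) = _
    rw [LinearMap.comp_apply, LinearEquiv.coe_coe, LinearMap.BilinForm.flip_apply, k3FormC_apply]
  set ν : complexBetti S (2 * 1) →ₗ[ℂ] complexBetti S (2 * 1) := ∑ i, ψ i with hνdef
  have hν : ∀ x, ν x = ∑ i, k3Form (η x) (fun j => (a i j : ℂ)) • η.symm (fun j => (b i j : ℂ)) := by
    intro x
    rw [hνdef, LinearMap.sum_apply]
    exact Finset.sum_congr rfl fun i _ => hψ i x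
  -- the `(2,0)`-class `σ = η⁻¹ x₀` and the Hodge types of `H²(S)`
  have hσ0 : η.symm x₀ ≠ 0 := fun h0 =>
    ne_zero_of_star_self_re_pos hxpos (by simpa using congrArg η h0)
  obtain ⟨h1, h2, h3⟩ := hHT S hS (η.symm x₀) h20 hσ0
  rw [conjClass_marking_symm η hηint] at h2 h3
  -- divisor classes are of type `(1,1)` (Grothendieck), hence orthogonal to `σ` and `σ̄`
  have hN11 : ∀ d ∈ algebraicClasses S 1, IsOfHodgeType 2 S (2 * 1) 1 1 d :=
    fun d hd => isOfHodgeType_oneOne_of_mem_algebraicClasses hG hS hd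
  have horth : ∀ w : K3Index → ℚ, η.symm (fun j => (w j : ℂ)) ∈ algebraicClasses S 1 →
      k3Form (fun j => (w j : ℂ)) x₀ = 0 ∧ k3Form (fun j => (w j : ℂ)) (star x₀) = 0 := by
    intro w hw
    obtain ⟨hw1, hw2⟩ := (h3 _).1 (hN11 _ hw)
    rw [hηcup, LinearEquiv.apply_symm_apply, LinearEquiv.apply_symm_apply, smul_eq_zero] at hw1 hw2
    exact ⟨hw1.resolve_right hp₀, hw2.resolve_right hp₀⟩
  -- X at the pair `(S, S)` for `Ξ = e + ν̃`
  obtain ⟨γ, hγ, hΞγ⟩ := hXS p₀ ⟨hp₀int, hp₀gen⟩ (e + ν)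
    (isRationalClass_add_correction hS η hηint e ν a b ξ hν hKB)
    (isOfHodgeType_add_correction hS η p₀ hηcup x₀ h1 h2 h3 e ν he_type a b hν
      (fun i => horth _ (ha i)) (fun i => horth _ (hb i)))
    (cupProduct_add_correction η p₀ hp₀ hηcup e ν a b ξ hν hKB hξ)
  -- fibre integration from Künneth spanning, and the divisor correspondences it yields
  obtain ⟨c, hc, hκ⟩ := fibreIntegral_of_kunnethTop μ hS.1 hS.1
    (kunnethSpan_complexBetti hS.1 hS.1 (2 * (2 + 2))) hp₀
  have hψind : ∀ i ∈ (Finset.univ : Finset (Fin m)), ∃ γ' ∈ algebraicClasses (S ⊗ S) 2,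
      ∀ x : complexBetti S (2 * 1), ψ i x =
        complexGysin μ (IsSmoothProjective.tensor_holds hS.1 hS.1) hS.1 (fst S S)
          (rfl : 2 * 1 + 2 * 2 + 2 * 2 = 2 * 1 + 2 * (2 + 2))
          (cupProduct (rfl : 2 * 1 + 2 * 2 = 2 * 1 + 2 * 2)
            (complexBetti.map (snd S S) (2 * 1) x) γ') := by
    intro i _
    obtain ⟨γ', hγ', hγ'eq⟩ :=
      divisorCorrespondence_of_fibreIntegral μ hμ S hS p₀ c hc hκ (ha i) (hb i)
    refine ⟨γ', hγ', fun x => ?_⟩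
    rw [hψ i x]
    exact (hγ'eq x _ (by rw [hηcup, LinearEquiv.apply_symm_apply])).symm
  have hνind := induced_sum (IsSmoothProjective.tensor_holds hS.1 hS.1) hS.1
    (rfl : 2 * 1 + 2 * 2 = 2 * 1 + 2 * 2) (rfl : 2 * 1 + 2 * 2 + 2 * 2 = 2 * 1 + 2 * (2 + 2))
    Finset.univ ψ hψind
  have h := induced_sub (IsSmoothProjective.tensor_holds hS.1 hS.1) hS.1
    (rfl : 2 * 1 + 2 * 2 = 2 * 1 + 2 * 2) (rfl : 2 * 1 + 2 * 2 + 2 * 2 = 2 * 1 + 2 * (2 + 2))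
    ⟨γ, hγ, hΞγ⟩ hνind
  rwa [← hνdef, add_sub_cancel_right] at h

/-- **X at the pairs `(S, S′)` for ONE surface `S`, from an algebraic anchor `r`-similitude INTO
`S`, Buskin's theorem and the composition of correspondences** (pointwise form of
`Theorems.similitudeAlgebraic_of_anchor`, whose anchor hypothesis is only ever used at the given
`S`): if `S` has a projective K3 partner `S″` and an algebraic `ℂ`-linear equivalence
`Ψ : H²(S″) ≃ H²(S)` whose inverse is rational, type-preserving and divides cup products by `r`,
then every rational, type-preserving `r`-similitude `ψ : H²(S′) → H²(S)` from a projective K3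
surface `S′` is algebraic on `S × S′`: `Ψ⁻¹ ∘ ψ` is a rational Hodge isometry, algebraic by (B) =
`HodgeIsometryAlgebraic` (Buskin), and `ψ = Ψ ∘ (Ψ⁻¹ ∘ ψ)` is algebraic by (C) = composition of
algebraic degree-`2` correspondences between surfaces. [cite: Varesco2023, §2]
[cite: Buskin2019, Thm. 1.1 and Lemma 6.3] -/
theorem similitudeAlgebraic_at_of_anchor_at (r : ℂ) (hB : Theses.NikulinTwinTransport.HodgeIsometryAlgebraic)
    (hC : ∀ (μ : OrientationFamily), μ.HasPoincareDuality →
      ∀ (A B C : SchemeOver ℂ) (hA : IsSmoothProjective 2 A) (hB : IsSmoothProjective 2 B)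
        (hC : IsSmoothProjective 2 C),
        ∀ γ ∈ algebraicClasses (A ⊗ B) 2, ∀ γ₁ ∈ algebraicClasses (B ⊗ C) 2,
          ∃ γ₂ ∈ algebraicClasses (A ⊗ C) 2, ∀ x : complexBetti C (2 * 1),
            complexGysin μ (IsSmoothProjective.tensor_holds hA hC) hA (fst A C)
                (rfl : 2 * 1 + 2 * 2 + 2 * 2 = 2 * 1 + 2 * (2 + 2))
                (cupProduct (rfl : 2 * 1 + 2 * 2 = 2 * 1 + 2 * 2)
                  (complexBetti.map (snd A C) (2 * 1) x) γ₂) =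
              complexGysin μ (IsSmoothProjective.tensor_holds hA hB) hA (fst A B)
                (rfl : 2 * 1 + 2 * 2 + 2 * 2 = 2 * 1 + 2 * (2 + 2))
                (cupProduct (rfl : 2 * 1 + 2 * 2 = 2 * 1 + 2 * 2)
                  (complexBetti.map (snd A B) (2 * 1)
                    (complexGysin μ (IsSmoothProjective.tensor_holds hB hC) hB (fst B C)
                      (rfl : 2 * 1 + 2 * 2 + 2 * 2 = 2 * 1 + 2 * (2 + 2))
                      (cupProduct (rfl : 2 * 1 + 2 * 2 = 2 * 1 + 2 * 2)
                        (complexBetti.map (snd B C) (2 * 1) x) γ₁)))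
                  γ))
    (μ : OrientationFamily) (hμ : μ.HasPoincareDuality) {S : SchemeOver ℂ} (hS : IsK3Surface S)
    (p : complexBetti S (2 * 2))
    (hA : ∃ (S'' : SchemeOver ℂ) (hS'' : IsK3Surface S'') (p'' : complexBetti S'' (2 * 2)),
      (IsIntegralClass p'' ∧
        ∀ q : complexBetti S'' (2 * 2), IsIntegralClass q → ∃ n : ℤ, q = n • p'') ∧
      ∃ Ψ : complexBetti S'' (2 * 1) ≃ₗ[ℂ] complexBetti S (2 * 1),
        (∀ y, IsRationalClass y → IsRationalClass (Ψ.symm y)) ∧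
        (∀ (i j : ℕ) y, IsOfHodgeType 2 S (2 * 1) i j y →
          IsOfHodgeType 2 S'' (2 * 1) i j (Ψ.symm y)) ∧
        (∀ (u v : complexBetti S (2 * 1)) (b : ℂ),
          cupProduct (rfl : 2 * 1 + 2 * 1 = 2 * 2) u v = (r * b) • p →
            cupProduct (rfl : 2 * 1 + 2 * 1 = 2 * 2) (Ψ.symm u) (Ψ.symm v) = b • p'') ∧
        ∃ γ ∈ algebraicClasses (S ⊗ S'') 2, ∀ x : complexBetti S'' (2 * 1),
          Ψ x = complexGysin μ (IsSmoothProjective.tensor_holds hS.1 hS''.1) hS.1 (fst S S'')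
            (rfl : 2 * 1 + 2 * 2 + 2 * 2 = 2 * 1 + 2 * (2 + 2))
            (cupProduct (rfl : 2 * 1 + 2 * 2 = 2 * 1 + 2 * 2)
              (complexBetti.map (snd S S'') (2 * 1) x) γ))
    {S' : SchemeOver ℂ} (hS' : IsK3Surface S') (p' : complexBetti S' (2 * 2))
    (hp' : IsIntegralClass p' ∧ ∀ q : complexBetti S' (2 * 2), IsIntegralClass q → ∃ n : ℤ, q = n • p')
    (ψ : complexBetti S' (2 * 1) →ₗ[ℂ] complexBetti S (2 * 1))
    (hψr : ∀ x, IsRationalClass x → IsRationalClass (ψ x))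
    (hψt : ∀ (i j : ℕ) x, IsOfHodgeType 2 S' (2 * 1) i j x → IsOfHodgeType 2 S (2 * 1) i j (ψ x))
    (hψs : ∀ (x y : complexBetti S' (2 * 1)) (a : ℂ),
      cupProduct (rfl : 2 * 1 + 2 * 1 = 2 * 2) x y = a • p' →
        cupProduct (rfl : 2 * 1 + 2 * 1 = 2 * 2) (ψ x) (ψ y) = (r * a) • p) :
    ∃ γ ∈ algebraicClasses (S ⊗ S') 2, ∀ x : complexBetti S' (2 * 1),
      ψ x = complexGysin μ (IsSmoothProjective.tensor_holds hS.1 hS'.1) hS.1 (fst S S')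
        (rfl : 2 * 1 + 2 * 2 + 2 * 2 = 2 * 1 + 2 * (2 + 2))
        (cupProduct (rfl : 2 * 1 + 2 * 2 = 2 * 1 + 2 * 2)
          (complexBetti.map (snd S S') (2 * 1) x) γ) := by
  obtain ⟨S'', hS'', p'', hp'', Ψ, hΨr, hΨt, hΨs, γ, hγ, hΨγ⟩ := hA
  -- `φ := Ψ⁻¹ ∘ ψ : H²(S′) → H²(S″)` is a rational Hodge isometry, algebraic by Buskin
  obtain ⟨γ₁, hγ₁, hφγ₁⟩ :=
    hB μ hμ S'' S' hS'' hS' p'' p' hp'' hp' (Ψ.symm.toLinearMap ∘ₗ ψ)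
      (fun x hx => hΨr _ (hψr x hx)) (fun i j x hx => hΨt i j _ (hψt i j x hx))
      (fun x y a hxy => hΨs _ _ a (hψs x y a hxy))
  -- compose with the algebraic anchor `Ψ = [γ]_*`
  obtain ⟨γ₂, hγ₂, hcomp⟩ := hC μ hμ S S'' S' hS.1 hS''.1 hS'.1 γ hγ γ₁ hγ₁
  refine ⟨γ₂, hγ₂, fun x => ?_⟩
  rw [hcomp x, ← hφγ₁ x, ← hΨγ]
  simp

/-- **The pointwise chain: an algebraic anchor `2`-similitude into `S` (for every integral generator
of `H⁴(S(ℂ))`) makes real multiplication by `√2` on `S` algebraic**, granted Buskin's theorem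
(`HodgeIsometryAlgebraic`), the composition of algebraic correspondences between surfaces, and the
three named facts (markings, Hodge types of `H²(K3)`, Grothendieck's coniveau inclusion): the anchor
gives X at the pair `(S, S)` (`similitudeAlgebraic_at_of_anchor_at`), which gives `e = [γ]_*`
(`realMultiplication_algebraic_at`). This is what one anchor buys for the deliverable at that very
surface — e.g. an anchor on one maximal RM-`√2` family (the milestone rule of crux
`TwinTransportRMPicardTwo`) settles real multiplication on that family.
[cite: Varesco2023, §2 and Thm. 2.1] [cite: Buskin2019, Thm. 1.1] -/
theorem realMultiplication_algebraic_at_of_anchors_at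
    (hB : Theses.NikulinTwinTransport.HodgeIsometryAlgebraic)
    (hC : ∀ (μ : OrientationFamily), μ.HasPoincareDuality →
      ∀ (A B C : SchemeOver ℂ) (hA : IsSmoothProjective 2 A) (hB : IsSmoothProjective 2 B)
        (hC : IsSmoothProjective 2 C),
        ∀ γ ∈ algebraicClasses (A ⊗ B) 2, ∀ γ₁ ∈ algebraicClasses (B ⊗ C) 2,
          ∃ γ₂ ∈ algebraicClasses (A ⊗ C) 2, ∀ x : complexBetti C (2 * 1),
            complexGysin μ (IsSmoothProjective.tensor_holds hA hC) hA (fst A C)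
                (rfl : 2 * 1 + 2 * 2 + 2 * 2 = 2 * 1 + 2 * (2 + 2))
                (cupProduct (rfl : 2 * 1 + 2 * 2 = 2 * 1 + 2 * 2)
                  (complexBetti.map (snd A C) (2 * 1) x) γ₂) =
              complexGysin μ (IsSmoothProjective.tensor_holds hA hB) hA (fst A B)
                (rfl : 2 * 1 + 2 * 2 + 2 * 2 = 2 * 1 + 2 * (2 + 2))
                (cupProduct (rfl : 2 * 1 + 2 * 2 = 2 * 1 + 2 * 2)
                  (complexBetti.map (snd A B) (2 * 1)
                    (complexGysin μ (IsSmoothProjective.tensor_holds hB hC) hB (fst B C)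
                      (rfl : 2 * 1 + 2 * 2 + 2 * 2 = 2 * 1 + 2 * (2 + 2))
                      (cupProduct (rfl : 2 * 1 + 2 * 2 = 2 * 1 + 2 * 2)
                        (complexBetti.map (snd B C) (2 * 1) x) γ₁)))
                  γ))
    (hmark : Huybrechts_K3_marking_exists) (hHT : Huybrechts_K3_hodgeTypes_H2)
    (hG : Grothendieck1969_supportedClasses_le_hodgeConiveau)
    (μ : OrientationFamily) (hμ : μ.HasPoincareDuality) {S : SchemeOver ℂ} (hS : IsK3Surface S)
    (hA : ∀ (p : complexBetti S (2 * 2)),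
      (IsIntegralClass p ∧ ∀ q : complexBetti S (2 * 2), IsIntegralClass q → ∃ n : ℤ, q = n • p) →
      ∃ (S'' : SchemeOver ℂ) (hS'' : IsK3Surface S'') (p'' : complexBetti S'' (2 * 2)),
        (IsIntegralClass p'' ∧
          ∀ q : complexBetti S'' (2 * 2), IsIntegralClass q → ∃ n : ℤ, q = n • p'') ∧
        ∃ Ψ : complexBetti S'' (2 * 1) ≃ₗ[ℂ] complexBetti S (2 * 1),
          (∀ y, IsRationalClass y → IsRationalClass (Ψ.symm y)) ∧
          (∀ (i j : ℕ) y, IsOfHodgeType 2 S (2 * 1) i j y →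
            IsOfHodgeType 2 S'' (2 * 1) i j (Ψ.symm y)) ∧
          (∀ (u v : complexBetti S (2 * 1)) (b : ℂ),
            cupProduct (rfl : 2 * 1 + 2 * 1 = 2 * 2) u v = ((2 : ℂ) * b) • p →
              cupProduct (rfl : 2 * 1 + 2 * 1 = 2 * 2) (Ψ.symm u) (Ψ.symm v) = b • p'') ∧
          ∃ γ ∈ algebraicClasses (S ⊗ S'') 2, ∀ x : complexBetti S'' (2 * 1),
            Ψ x = complexGysin μ (IsSmoothProjective.tensor_holds hS.1 hS''.1) hS.1 (fst S S'')
              (rfl : 2 * 1 + 2 * 2 + 2 * 2 = 2 * 1 + 2 * (2 + 2))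
              (cupProduct (rfl : 2 * 1 + 2 * 2 = 2 * 1 + 2 * 2)
                (complexBetti.map (snd S S'') (2 * 1) x) γ))
    (e : complexBetti S (2 * 1) →ₗ[ℂ] complexBetti S (2 * 1))
    (he_rat : ∀ x, IsRationalClass x → IsRationalClass (e x))
    (he_type : ∀ (i j : ℕ) x, IsOfHodgeType 2 S (2 * 1) i j x → IsOfHodgeType 2 S (2 * 1) i j (e x))
    (he_adj : ∀ x y : complexBetti S (2 * 1),
      cupProduct (rfl : 2 * 1 + 2 * 1 = 2 * 2) (e x) y =
        cupProduct (rfl : 2 * 1 + 2 * 1 = 2 * 2) x (e y))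
    (he_N : ∀ d ∈ algebraicClasses S 1, e d = 0)
    (he_T : ∀ x : complexBetti S (2 * 1),
      (∀ d ∈ algebraicClasses S 1, cupProduct (rfl : 2 * 1 + 2 * 1 = 2 * 2) x d = 0) →
        e (e x) = (2 : ℂ) • x) :
    ∃ γ ∈ algebraicClasses (S ⊗ S) 2, ∀ x : complexBetti S (2 * 1),
      e x = complexGysin μ (IsSmoothProjective.tensor_holds hS.1 hS.1) hS.1 (fst S S)
        (rfl : 2 * 1 + 2 * 2 + 2 * 2 = 2 * 1 + 2 * (2 + 2))
        (cupProduct (rfl : 2 * 1 + 2 * 2 = 2 * 1 + 2 * 2)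
          (complexBetti.map (snd S S) (2 * 1) x) γ) :=
  realMultiplication_algebraic_at hmark hHT hG μ hμ hS
    (fun p hp ψ hψr hψt hψs =>
      similitudeAlgebraic_at_of_anchor_at 2 hB hC μ hμ hS p (hA p hp) hS p hp ψ hψr hψt hψs)
    e he_rat he_type he_adj he_N he_T

/-- **Real multiplication by `√2` on projective K3 surfaces is algebraic — the route decl
`RealMultiplicationSqrtTwoAlgebraic` BY NAME — granted RM-ANCHORS, Buskin's theorem, the
composition of correspondences and the three named facts.** An RM-anchor is the conclusion of the
crux `TwinTransportRMPicardTwo` (stmt-HodgeConjecture-15067): for a projective K3 surface `S`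
carrying a rational, type-preserving `e` killing `NS` with `e² = 2` on `NS^⊥`, a projective K3
partner `S″` and an ALGEBRAIC `ℂ`-linear equivalence `Ψ : H²(S″) ≃ H²(S)` whose inverse is a
rational, type-preserving `½`-similitude; the hypothesis `hA` is that crux VERBATIM WITHOUT its
Picard-rank clause `finrank NS = 2` (`IsK3Surface` folded). So the deliverable needs the transport
crux only ON THE RM-`√2` SURFACES THEMSELVES (not the universal `TwinTwistorTransport`, not X for
all pairs): `e + ν̃` is a rational Hodge `2`-similitude of `H²(S)`, `Ψ⁻¹ ∘ (e + ν̃)` a rational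
Hodge isometry `H²(S) → H²(S″)` (Buskin), `e + ν̃ = Ψ ∘ (Ψ⁻¹ ∘ (e + ν̃))` is algebraic by
composition, and `ν̃` is a sum of divisor correspondences.
[cite: Varesco2023, §2, Thm. 2.1 and Rem. 2.2] [cite: Buskin2019, Thm. 1.1 and Lemma 6.3]
[cite: VanGeemenSchuett2023, Thm. 3.10 and Rem. 4.9] -/
theorem realMultiplicationSqrtTwoAlgebraic_of_rmAnchors
    (hB : Theses.NikulinTwinTransport.HodgeIsometryAlgebraic)
    (hC : ∀ (μ : OrientationFamily), μ.HasPoincareDuality →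
      ∀ (A B C : SchemeOver ℂ) (hA : IsSmoothProjective 2 A) (hB : IsSmoothProjective 2 B)
        (hC : IsSmoothProjective 2 C),
        ∀ γ ∈ algebraicClasses (A ⊗ B) 2, ∀ γ₁ ∈ algebraicClasses (B ⊗ C) 2,
          ∃ γ₂ ∈ algebraicClasses (A ⊗ C) 2, ∀ x : complexBetti C (2 * 1),
            complexGysin μ (IsSmoothProjective.tensor_holds hA hC) hA (fst A C)
                (rfl : 2 * 1 + 2 * 2 + 2 * 2 = 2 * 1 + 2 * (2 + 2))
                (cupProduct (rfl : 2 * 1 + 2 * 2 = 2 * 1 + 2 * 2)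
                  (complexBetti.map (snd A C) (2 * 1) x) γ₂) =
              complexGysin μ (IsSmoothProjective.tensor_holds hA hB) hA (fst A B)
                (rfl : 2 * 1 + 2 * 2 + 2 * 2 = 2 * 1 + 2 * (2 + 2))
                (cupProduct (rfl : 2 * 1 + 2 * 2 = 2 * 1 + 2 * 2)
                  (complexBetti.map (snd A B) (2 * 1)
                    (complexGysin μ (IsSmoothProjective.tensor_holds hB hC) hB (fst B C)
                      (rfl : 2 * 1 + 2 * 2 + 2 * 2 = 2 * 1 + 2 * (2 + 2))
                      (cupProduct (rfl : 2 * 1 + 2 * 2 = 2 * 1 + 2 * 2)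
                        (complexBetti.map (snd B C) (2 * 1) x) γ₁)))
                  γ))
    (hA : ∀ (μ : OrientationFamily), μ.HasPoincareDuality →
      ∀ (S : SchemeOver ℂ) (hS : IsK3Surface S) (p : complexBetti S (2 * 2)),
      (IsIntegralClass p ∧ ∀ q : complexBetti S (2 * 2), IsIntegralClass q → ∃ n : ℤ, q = n • p) →
      ∀ (e : complexBetti S (2 * 1) →ₗ[ℂ] complexBetti S (2 * 1)),
        (∀ x, IsRationalClass x → IsRationalClass (e x)) →
        (∀ (i j : ℕ) x, IsOfHodgeType 2 S (2 * 1) i j x → IsOfHodgeType 2 S (2 * 1) i j (e x)) →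
        (∀ d ∈ algebraicClasses S 1, e d = 0) →
        (∀ x : complexBetti S (2 * 1),
          (∀ d ∈ algebraicClasses S 1, cupProduct (rfl : 2 * 1 + 2 * 1 = 2 * 2) x d = 0) →
            e (e x) = (2 : ℂ) • x) →
      ∃ (S'' : SchemeOver ℂ) (hS'' : IsK3Surface S'') (p'' : complexBetti S'' (2 * 2)),
        (IsIntegralClass p'' ∧
          ∀ q : complexBetti S'' (2 * 2), IsIntegralClass q → ∃ n : ℤ, q = n • p'') ∧
        ∃ Ψ : complexBetti S'' (2 * 1) ≃ₗ[ℂ] complexBetti S (2 * 1),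
          (∀ y, IsRationalClass y → IsRationalClass (Ψ.symm y)) ∧
          (∀ (i j : ℕ) y, IsOfHodgeType 2 S (2 * 1) i j y →
            IsOfHodgeType 2 S'' (2 * 1) i j (Ψ.symm y)) ∧
          (∀ (u v : complexBetti S (2 * 1)) (b : ℂ),
            cupProduct (rfl : 2 * 1 + 2 * 1 = 2 * 2) u v = ((2 : ℂ) * b) • p →
              cupProduct (rfl : 2 * 1 + 2 * 1 = 2 * 2) (Ψ.symm u) (Ψ.symm v) = b • p'') ∧
          ∃ γ ∈ algebraicClasses (S ⊗ S'') 2, ∀ x : complexBetti S'' (2 * 1),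
            Ψ x = complexGysin μ (IsSmoothProjective.tensor_holds hS.1 hS''.1) hS.1 (fst S S'')
              (rfl : 2 * 1 + 2 * 2 + 2 * 2 = 2 * 1 + 2 * (2 + 2))
              (cupProduct (rfl : 2 * 1 + 2 * 2 = 2 * 1 + 2 * 2)
                (complexBetti.map (snd S S'') (2 * 1) x) γ))
    (hmark : Huybrechts_K3_marking_exists) (hHT : Huybrechts_K3_hodgeTypes_H2)
    (hG : Grothendieck1969_supportedClasses_le_hodgeConiveau) :
    Theses.NikulinTwinTransport.RealMultiplicationSqrtTwoAlgebraic :=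
  fun μ hμ _S hS e he_rat he_type he_adj he_N he_T =>
    realMultiplication_algebraic_at_of_anchors_at hB hC hmark hHT hG μ hμ hS
      (fun p hp => hA μ hμ _ hS p hp e he_rat he_type he_N he_T) e he_rat he_type he_adj he_N he_T

end Summit.HodgeConjecture.HodgeConjecture.Theorems.NikulinTwinTransport

end
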